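import Summits.QuantumFields.BalabanUV.T4Continuum.Spine.NE1p.DressedSmallFieldOnCoresSlotLettersTorus
import Summits.QuantumFields.BalabanUV.T4Continuum.Spine.NE1p.DressedSmallFieldSlotWitness
import Summits.QuantumFields.BalabanUV.T4Continuum.Support.SubstrateFrameOfRecord

/-!
# T⁴ programme, spine estimate NE1′ (node O3b/H2) — WITNESS W58 «THE SLOT-LETTERS END FIRES ON THE TORUS», PART 1: THE FIRST DECIDED
# `ActLetters` DATUM — a 1×1 Gaussian table `linForm base rd o a = [2 + ϑ·o]` whose read-out of the operator datum is LIVE (`rd ≠ 0`),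
# over ANY driven two-run object `D : DrivenRuns G` and the substrate's frame of record on `D.carriers`; S30 §1's displayed per-factor
# scalar conditions and CENTRE CONDITIONS met with stated margins; p3's Gaussian letters of record `gaussN ∕ gaussQ ∘ linForm` COMPUTED —
# they DEPEND on the operator datum

Cell `pub-balaban`, sub-cell `t4`, row NE1′ formalisation crew (`t4/formal/NE1p/LEAVES.md` row W58 ∕ DAG N29zzzf «THE SLOT-LETTERS END FIRES ON THE TORUS
— A DECIDED `ActLetters` DATUM WITH LIVE GAUSSIAN LETTERS, UNIFORM IN THE DRIVEN RUNS», BOOKED typer R-T133 (ii) from OPEN OFFER O-g14 of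
R-T132 (ii); INTENT `CLAIMS.log` l.20840, PROTOTYPE l.20984, STAGED l.21120; own-initiative witness under R-T61 (ii) ∕
R-T80 (vi)), unit `b2b-balaban-t4-ne1p-formalise-leaf-04` (LEAF PROVER 04, gen 15; the torus-faces lineage S29∕S31∕S36∕S38∕W24∕W38).
ADDITIVE — imports S31 `Spine/NE1p/DressedSmallFieldOnCoresSlotLettersTorus` (leaf-04-g13, p229710; ⇒ S30 `DressedSmallFieldOnCoresSlotLetters`
p228879 ⇒ N0r, and the SUBSTRATE cell's `SubstrateSlotsOfRecord` (`ActLetters`, `coreLettersOf`), `SubstrateGaussianLetters{,Ball}` (`linForm`,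
`gaussN`, `gaussQ`, `gaussC`, `detBudget`), `SubstrateActivities` (`coreOf`, `actOfLetters`)), W40 `Spine/NE1p/DressedSmallFieldSlotWitness`
(leaf-10-g9, p229395; ⇒ W33 `E1`∕`crd`∕`Acst`∕`gaussian_E1`, W24 `X₀`∕`eq_X₀_iff`∕`hrate_torus_num`∕`dressedConst_le_one`∕`exp_locE_cube`, row
NE5's `B13HistWitness.toyConsts`) and the substrate's `Support/SubstrateFrameOfRecord` (`frameOfDriven`, p1) ONLY — all LANDED; toy DATA
`def`∕`abbrev`s + theorems; 0 `def … : Prop`, 0 cite, 0 sorry; nothing of S30 ∕ S31 ∕ N0m–N0r ∕ the substrate ∕ row NE5 ∕ W24 ∕ W33 ∕ W40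
restated — their declarations are used BY NAME.

WHY.  The slot-letters column S30 → S31∕S32∕S35∕S36∕S38 (and S46) types N0r §3's slot END at the substrate's CORE LETTERS OF RECORD
`coreLettersOf A` for a factor-letter record `A : ∀ Z j, ActLetters D P Op 𝒵 dom Jc V mI Z j`, N0r's operator-letter blocks DISCHARGED by
S30 §1 into displayed per-factor scalar conditions (`hbase`∕`hrdm`∕`hβ₀`∕`hd₀`∕`hR′`∕`hrd`, the CENTRE CONDITIONS `hctr`, `hbud`∕`hmq`).  No
module of the tree CONSTRUCTED an `ActLetters` term (tree grep at INTENT: the six face files + the defining Support file only), so those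
face rows had no decided inhabitant — their joint hypotheses were unchecked for vacuity.  THIS FILE (PART 1) builds one, UNIFORMLY in `D`:
* §0 the frame of record `PW D := frameOfDriven D ℝ 1 … toyConsts toy_posUnits` on `D.carriers`, the polymer domain `Z₀ D := D.mkDom 0
  (singleDom 0)` (tree length `0`), ONE measurable table `tabW D` (row O1-c's `ofMeasPotentials`: `V″ := level136 toyConsts (d Y)`, `Q := 0`,
  factor `1`; `VppM_tabW_Z₀ : V″(tabW)(Z₀, φ) = 1` BY THEOREM, not `rfl`);
* §1 THE DATUM `AW D : ∀ Z j, ActLetters D (PW D) ℂ (𝒵W D) (domW D) (JcW D) (VW D) (mIW D) Z j` — ONE polymer (`𝒵 := Unit`) sitting at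
  its own domain (`dom Z j Y := Z`), NO cube contour (`Jc := PEmpty`: the `κ₁ := 1` letter is idle through an empty product — DECLARED, as
  in W33∕W40), (2.18) radius `rW := 32∕A` in W33's located `A = (e·K₀(64,8)·9·64)⁻¹` (LARGE, so that the Cauchy weight letter pays (B3) —
  PART 2), no χ-constraints, CONSTANT field map `B Y v := 0`, model input `mI := Fin 1`, flat variable `V := E1` with `coords := id`, base
  table `[2]` and **read-out `rd := ϑW • id` (`ϑW = 1`)**: `linForm_AW : linForm base rd o a = [2 + ϑW·o]`, `norm_rd_AW : ‖rd a ii jj‖ = ϑW`,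
  `rd_AW_ne_zero`, `linForm_AW_injective` — the Gaussian table READS the operator datum; `det_linForm_AW`, `re_quadForm_AW`;
* §2 S30 §1's binders as NAMED LEMMAS on this datum: `hbase_W`, `hrdm_W`, `hrd_W` and **`hctr_W`** at the class centre `ctrW := (0, 0)`
  ((i) entry `‖2‖ ≤ β₀ := 2`, (ii) `det = 2` real, (iii) `re det = 2 ≥ d₀ := 2`, (iv) `γ := 2`-coercivity WITH EQUALITY), **`hbud_W :
  detBudget 1 2 ϑW 1 = 1 < 2`** and **`hmq_W : 1·ϑW·1 = 1 < 2`** at the operator radius `R′ := 1` — margins `1` STATED (S30 §1's margin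
  letter `mq = (γ − card·ϑ·R′)∕2 = 1∕2` is thereby PROVED positive; the operator ball `‖o‖ < 1` keeps `2 + ϑW·o` off the branch cut);
* §3 **THE GAUSSIAN LETTERS OF RECORD, COMPUTED** (`coreLettersOf_N`∕`_q` are `rfl`): `N_ℓW : N o a = (2π)^{−1∕2}·exp(log(2 + ϑW·o)∕2)`,
  `q_ℓW : q o a v = ½·(2 + ϑW·o)·(v 0)²` — LIVE in `o`; AT THE CENTRE `N_ℓW_zero : N 0 a = π^{−1∕2}`, `q_ℓW_zero : q 0 a v = ‖v‖²` (W33∕W40's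
  DECLARED toy letters, here DERIVED from the table).
PART 2 (`DressedSmallFieldSlotLettersWitnessEnd`): the core's letters BY NAME, the activity of record AT THE CENTRE in closed form, (B3) as a
letter budget MET, S31 §1's END APPLIED ONCE BY NAME for every `D` and every run-B background `U`, GENUINENESS, and the schema's parameters
INHABITED by the substrate's HYPOTHESIS-FREE driven object of record at `SU(2)`.

HONEST FRAMING (typer R-T132 (ii) wording + rider ADOPTED).  A DECIDED TOY ([folklore]; 0 sorry; 0 citations; no `def … : Prop` — the
`def`s are toy DATA): the substrate's FORMAT (`ActLetters` → `coreLettersOf` → `coreOf = ofContours` → `actOfLetters`) with p3's PROVED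
finite-dimensional Gaussian letters on a 1×1 table OF OUR CHOOSING, over the frame of record with row NE5's toy constants; the operator-letter
blocks are exercised on a datum where they are NOT idle (holomorphy and bound of `(2 + ϑW·o)^{1∕2}` on the operator ball need `ϑW·R′ < 2`) —
nothing more; the toy SIZES (`Jc := PEmpty`, ONE polymer, `mI := Fin 1`) are NOT representative of Bałaban's (2.14) index sets, and the
construction is uniform in `D` only because the toy reads `D` through its carrier index and frame TYPES (typer R-T133 (δ)).  Which tables realise Bałaban's `C^{(k)}(Z₀,σ)`, `Γ_k` of [Balaban1988RGII] (2.14) p. 15 and whether the datum OF RECORD meets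
the centre conditions is the SUBSTRATE's displayed identification — NOT touched; (B1b)'s residue is BY DEFINITION of the toy; `2`, `ϑW`,
`rW`, `2π`, `√π` are OUR toy arithmetic — k2: no numeral of print asserted; (B3) = G-ne9p2-5 stays UNPRINTED for Bałaban's cores; 0 binders
instantiated on Bałaban's densities; no wall item discharged; wall v1.7 (T4-DAG v47) does NOT move; R-t4r2-Q2 NOT met thereby; NE1′ ⇐ the
named binders — NOT proved, NOT printed; spine PROVED 0∕9; count 9 unchanged.  Rung (B)+1 on ONE finite four-torus — NOT infinite volume,
NOT a mass gap, NOT OS on ℝ⁴, NOT Clay.  HONEST DEPENDENCY: continuum YM on T⁴ ⇐ BetaPertH ∧ nine spine estimates (0/9 proved);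
BetaPertH ⇐ (D1) ∧ (D4) ∧ CAP+tail; G-an2-4 gates asym, D1 and NE2/3/4.
-/

noncomputable section

namespace Summit.QuantumFields.BalabanUV.T4Continuum.NE1p.DressedSmallFieldSlotLettersWitness

open Set Metric MeasureTheory Complex
open scoped BigOperators Matrix
open Literature.MathematicalPhysics.QuantumFieldTheory.Balaban1983to89
open Literature.MathematicalPhysics.QuantumFieldTheory.Balaban1983to89.B5Prop11Lower (nsq)
open Summit.QuantumFields.BalabanUV.T4Continuum.B13HistDatum (level136 level143)
open Summit.QuantumFields.BalabanUV.T4Continuum.B13HistMeasurable (MeasPotFrame B13HistM)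
open Summit.QuantumFields.BalabanUV.T4Continuum.B13HistWitness (toyConsts toy_posUnits level136_toy)
open Summit.QuantumFields.BalabanUV.T4Continuum.B13Carriers (TwoRuns singleDom singleDom_val)
open Summit.QuantumFields.BalabanUV.T4Continuum.SubstrateTwoRunsDriven (DrivenRuns)
open Summit.QuantumFields.BalabanUV.T4Continuum.SubstrateFrameOfRecord (frameOfDriven)
open Summit.QuantumFields.BalabanUV.T4Continuum.SubstrateActivities (CoreLetters)
open Summit.QuantumFields.BalabanUV.T4Continuum.SubstrateGaussianLetters (gaussQ gaussC gaussN linForm linForm_apply)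
open Summit.QuantumFields.BalabanUV.T4Continuum.SubstrateGaussianLettersBall (detBudget)
open Summit.QuantumFields.BalabanUV.T4Continuum.SubstrateSlotsOfRecord (ActLetters coreLettersOf coreLettersOf_N coreLettersOf_q)
open Summit.QuantumFields.BalabanUV.T4Continuum.NE1p.DressedSmallFieldCoresWitness (E1 crd Acst Acst_pos)
open Summit.QuantumFields.BalabanUV.T4Continuum.NE1p.DressedSmallFieldTorusWitness (dressedConst_le_one)

/-! ## §0 The driven runs of record, the frame of record, one measurable table -/

variable {G : Type} [GaugeGroup G] (D : DrivenRuns G)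

/-- THE FRAME OF RECORD on its carriers: real bond letters with one complex coordinate, toy constants (all ones). [folklore] -/
def PW : MeasPotFrame D.carriers :=
  frameOfDriven D ℝ 1 (fun x _ => (x : ℂ)) (fun _ => Complex.measurable_ofReal) toyConsts toy_posUnits

/-- The polymer domain of the one factor: the cube `0` at scale `0` of the carriers of record. [folklore] -/
def Z₀ : D.carriers.Dom := D.mkDom 0 (singleDom 0)

/-- Its tree length is `0`. [folklore] -/
@[simp] theorem d_Z₀ : D.carriers.d (Z₀ D) = 0 := D.toTwoRuns.d_singleDom 0 0

/-- The remainder potentials of the table: the (1.36)-format weight itself (constant in the field argument). [folklore] -/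
def tabV : (Y : D.carriers.Dom) → (PW D).Arg Y → ℂ := fun Y _ => (level136 toyConsts (D.carriers.d Y) : ℂ)
/-- The kernel entries `Q ≡ 0`. [folklore] -/
def tabQ : (Y : D.carriers.Dom) → (PW D).Arg Y → (PW D).Bond Y → (PW D).Bond Y → ℂ := fun _ _ _ _ => 0

/-- (1.36): `|V″(Y, φ)| ≤ 1 ×` the (1.36)-format weight — WITH EQUALITY by construction. [folklore] -/
theorem tabV_bound (Y : D.carriers.Dom) (φ : (PW D).Arg Y) : ‖(tabV D) Y φ‖ ≤ 1 * level136 (PW D).consts (D.carriers.d Y) := by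
  rw [one_mul]; show ‖((level136 toyConsts (D.carriers.d Y) : ℝ) : ℂ)‖ ≤ level136 toyConsts (D.carriers.d Y)
  rw [Complex.norm_real, Real.norm_eq_abs, abs_of_pos (B13HistDatum.level136_pos toy_posUnits _)]

/-- (1.43): `‖0‖ ≤ 1 ×` the (1.43)-format weight. [folklore] -/
theorem tabQ_bound (Y : D.carriers.Dom) (φ : (PW D).Arg Y) (b b' : (PW D).Bond Y) :
    ‖(tabQ D) Y φ b b'‖ ≤ 1 * level143 (PW D).consts (D.carriers.d Y) ((PW D).vol Y) := by
  rw [tabQ, norm_zero, one_mul]; exact (B13HistDatum.level143_pos toy_posUnits _ _).le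

/-- THE TABLE (toy DATA), by row O1-c's measurable constructor with factor `1`. [folklore] -/
def tabW : B13HistM (PW D) :=
  (PW D).ofMeasPotentials (tabV D) (tabQ D) 1 (tabV_bound D) (tabQ_bound D) (fun _ => measurable_const) (fun _ _ _ => measurable_const)

/-- The constructor reproduces `V″` — BY THEOREM (`VppM_ofMeasPotentials`), not by `rfl`. [folklore] -/
@[simp] theorem VppM_tabW (Y : D.carriers.Dom) (φ : (PW D).Arg Y) : (PW D).VppM (tabW D) Y φ = (level136 toyConsts (D.carriers.d Y) : ℂ) :=
  (PW D).VppM_ofMeasPotentials (tabV D) (tabQ D) 1 (tabV_bound D) (tabQ_bound D) _ _ Y φ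

/-- At the one-cube polymer domain the table reads `1` (`level136 toyConsts 0 = 1`, row NE5's `level136_toy`). [folklore] -/
theorem VppM_tabW_Z₀ (φ : (PW D).Arg (Z₀ D)) : (PW D).VppM (tabW D) (Z₀ D) φ = 1 := by rw [VppM_tabW, d_Z₀, level136_toy]; simp

/-- The table lies in the unit ball. [folklore] -/
theorem norm_tabW_le : ‖(tabW D)‖ ≤ 1 := (PW D).norm_ofMeasPotentials_le _ _ zero_le_one _ _ _ _

/-! ## §1 The factor-letter record (toy DATA): ONE polymer, no cube contour, a 1×1 Gaussian table with a LIVE read-out -/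

/-- Polymer-family types per factor: ONE polymer `Y` (toy DATA). [folklore] -/
abbrev 𝒵W : D.carriers.Dom → Unit → Type := fun _ _ => Unit
/-- … sitting at the factor's own carrier domain `Z` (toy DATA). [folklore] -/
abbrev domW : ∀ (Z : D.carriers.Dom) (j : Unit), (𝒵W D) Z j → D.carriers.Dom := fun Z _ _ => Z
/-- Cube index per factor: NO cube contour (toy DATA; the `κ₁` letter enters `wB` through an empty product only — DECLARED). [folklore] -/
abbrev JcW : D.carriers.Dom → Unit → Type := fun _ _ => PEmpty.{1}
/-- Flat fluctuation space per factor: one real Gaussian variable (NE5's `E1` convention, via W33). [folklore] -/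
abbrev VW : D.carriers.Dom → Unit → Type := fun _ _ => E1
/-- Model input of the Gaussian table per factor: ONE flat coordinate (`Fin 1` — a 1×1 table). [folklore] -/
abbrev mIW : D.carriers.Dom → Unit → Type := fun _ _ => Fin 1

/-- The (2.18) radius of the one polymer contour: `rW := 32 / A` with W33's located `A = (e·K₀(64,8)·9·64)⁻¹` — LARGE, so that the
Cauchy weight letter `lam·wB = r/(r−1)²` pays (B3)'s letter budget. [folklore] -/
def rW : ℝ := 32 / Acst

/-- `rW ≥ 32` (W24's `dressedConst_le_one`: `A ≤ 1`). [folklore] -/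
theorem rW_ge : 32 ≤ rW := by
  unfold rW; rw [le_div_iff₀ Acst_pos]
  calc (32 : ℝ) * Acst ≤ 32 * 1 := by gcongr; exact dressedConst_le_one
    _ = 32 := mul_one _

/-- The (2.18) KIND of the radius: `rW > 1`. [folklore] -/
theorem one_lt_rW : 1 < rW := by linarith [rW_ge]

/-- The read-out strength `ϑW := 1` of the operator datum in the Gaussian table. [folklore] -/
def ϑW : ℝ := 1

/-- **THE FACTOR LETTERS** (toy DATA). [folklore] -/
def AW : ∀ (Z : D.carriers.Dom) (j : Unit), ActLetters D (PW D) ℂ (𝒵W D) (domW D) (JcW D) (VW D) (mIW D) Z j := fun _ _ =>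
  { κ₁ := 1
    κ₁_pos := one_pos
    r := fun _ => rW
    one_lt_r := fun _ => one_lt_rW
    cons := []
    nsign := 0
    B := fun _ _ => fun _ => (0 : ℝ)
    measB := fun _ => measurable_const
    base := fun _ => Matrix.of fun _ _ => (2 : ℂ)
    rd := fun _ _ _ => (ϑW : ℂ) • ContinuousLinearMap.id ℂ ℂ
    coords := LinearIsometry.id }

/-- The affine reading of the operator datum: `linForm base rd o a = [2 + ϑW·o]`. [folklore] -/
theorem linForm_AW (Z : D.carriers.Dom) (j : Unit) (o : ℂ) (a : (PEmpty.{1} ⊕ Unit) → ℝ × ℝ) (i i' : Fin 1) :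
    linForm ((AW D) Z j).base ((AW D) Z j).rd o a i i' = 2 + (ϑW : ℂ) * o := by
  rw [linForm_apply]; rfl


/-- Its determinant: `det [2 + ϑW·o] = 2 + ϑW·o`. [folklore] -/
theorem det_linForm_AW (Z : D.carriers.Dom) (j : Unit) (o : ℂ) (a : (PEmpty.{1} ⊕ Unit) → ℝ × ℝ) :
    (linForm ((AW D) Z j).base ((AW D) Z j).rd o a).det = 2 + (ϑW : ℂ) * o := by
  rw [Matrix.det_fin_one, linForm_AW]

/-- The quadratic form of the reading: `Re (x̄ᵀ·[2 + ϑW·o]·x) = Re(2 + ϑW·o)·Σ|x_i|²`. [folklore] -/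
theorem re_quadForm_AW (Z : D.carriers.Dom) (j : Unit) (o : ℂ) (a : (PEmpty.{1} ⊕ Unit) → ℝ × ℝ) (x : Fin 1 → ℂ) :
    (star x ⬝ᵥ (linForm ((AW D) Z j).base ((AW D) Z j).rd o a *ᵥ x)).re = (2 + (ϑW : ℂ) * o).re * nsq x := by
  simp only [dotProduct, Matrix.mulVec, Fin.sum_univ_one, Pi.star_apply, linForm_AW, nsq]
  rw [show star (x 0) * ((2 + (ϑW : ℂ) * o) * x 0) = (2 + (ϑW : ℂ) * o) * (starRingEnd ℂ (x 0) * x 0) by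
    rw [Complex.star_def]; ring, Complex.conj_mul', ← Complex.ofReal_pow, Complex.re_mul_ofReal]

/-! ## §2 S30 §1's DISPLAYED per-factor scalar conditions, MET — the centre conditions with a stated margin -/

/-- The class centres: operator datum `0`, table `0` (toy DATA). [folklore] -/
def ctrW : ℕ → (ℕ → ℝ) → D.carriers.BgB → ℂ × B13HistM (PW D) := fun _ _ _ => (0, 0)

/-- `hbase`: the base table is measurable in the contour parameter (constant). [folklore] -/
theorem hbase_W : ∀ (Z : D.carriers.Dom) (j : Unit) (ii jj : Fin 1), Measurable fun a => ((AW D) Z j).base a ii jj :=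
  fun _ _ _ _ => measurable_const
/-- `hrdm`: the read-outs are measurable in the contour parameter (constant). [folklore] -/
theorem hrdm_W : ∀ (Z : D.carriers.Dom) (j : Unit) (ii jj : Fin 1) (o' : ℂ), Measurable fun a => ((AW D) Z j).rd a ii jj o' :=
  fun _ _ _ _ _ => measurable_const
/-- `hrd` WITH EQUALITY: the read-out letter `‖rd a ii jj‖ = ϑW` — the operator datum IS read (`rd ≠ 0`). [folklore] -/
theorem norm_rd_AW (Z : D.carriers.Dom) (j : Unit) (a : (PEmpty.{1} ⊕ Unit) → ℝ × ℝ) (ii jj : Fin 1) :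
    ‖((AW D) Z j).rd a ii jj‖ = ϑW := by
  show ‖(ϑW : ℂ) • ContinuousLinearMap.id ℂ ℂ‖ = ϑW
  rw [norm_smul, ContinuousLinearMap.norm_id, mul_one, Complex.norm_real, Real.norm_eq_abs, ϑW, abs_one]
/-- `hrd`. [folklore] -/
theorem hrd_W : ∀ (Z : D.carriers.Dom) (j : Unit) (a : (PEmpty.{1} ⊕ Unit) → ℝ × ℝ) (ii jj : Fin 1),
    ‖((AW D) Z j).rd a ii jj‖ ≤ (fun (_ : D.carriers.Dom) (_ : Unit) => ϑW) Z j := fun Z j a ii jj => ((norm_rd_AW D) Z j a ii jj).le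
/-- The read-out is NOT idle: `rd a ii jj ≠ 0`. [folklore] -/
theorem rd_AW_ne_zero (Z : D.carriers.Dom) (j : Unit) (a : (PEmpty.{1} ⊕ Unit) → ℝ × ℝ) (ii jj : Fin 1) : ((AW D) Z j).rd a ii jj ≠ 0 := by
  intro h; have h1 := (norm_rd_AW D) Z j a ii jj; rw [h, norm_zero, ϑW] at h1; exact zero_ne_one h1
/-- … so the Gaussian table DEPENDS on the operator datum: `linForm … o ≠ linForm … 0` for `o ≠ 0`. [folklore] -/
theorem linForm_AW_injective (Z : D.carriers.Dom) (j : Unit) (a : (PEmpty.{1} ⊕ Unit) → ℝ × ℝ) {o : ℂ} (ho : o ≠ 0) :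
    linForm ((AW D) Z j).base ((AW D) Z j).rd o a ≠ linForm ((AW D) Z j).base ((AW D) Z j).rd 0 a := by
  intro h
  have h1 := congrFun (congrFun h 0) 0
  rw [linForm_AW, linForm_AW, ϑW, mul_zero, add_zero] at h1
  exact ho (by simpa using h1)

/-- **THE CENTRE CONDITIONS `hctr`, MET** at the class centre `0`: (i) entry `‖2‖ ≤ β₀ := 2`, (ii) `det = 2` REAL, (iii) `re det = 2 ≥ d₀ := 2`,
(iv) `γ := 2`-coercivity WITH EQUALITY `2·Σ|x_i|² = Re(x̄ᵀ·[2]·x)`. [folklore] -/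
theorem hctr_W : ∀ k, ∀ g ∈ (Set.univ : Set (ℕ → ℝ)), ∀ (U : D.carriers.BgB) (Z : D.carriers.Dom) (j : Unit)
    (a : ((JcW D) Z j ⊕ (𝒵W D) Z j) → ℝ × ℝ),
    (∀ ii jj, ‖linForm ((AW D) Z j).base ((AW D) Z j).rd ((ctrW D) k g U).1 a ii jj‖ ≤ (fun (_ : D.carriers.Dom) (_ : Unit) => (2 : ℝ)) Z j) ∧
    ((linForm ((AW D) Z j).base ((AW D) Z j).rd ((ctrW D) k g U).1 a).det).im = 0 ∧
    (fun (_ : D.carriers.Dom) (_ : Unit) => (2 : ℝ)) Z j ≤ ((linForm ((AW D) Z j).base ((AW D) Z j).rd ((ctrW D) k g U).1 a).det).re ∧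
    (∀ x : (mIW D) Z j → ℂ, (fun (_ : D.carriers.Dom) (_ : Unit) => (2 : ℝ)) Z j * nsq x ≤
      (star x ⬝ᵥ (linForm ((AW D) Z j).base ((AW D) Z j).rd ((ctrW D) k g U).1 a *ᵥ x)).re) := by
  intro k g _ U Z j a
  have h0 : ((ctrW D) k g U).1 = 0 := rfl
  refine ⟨fun ii jj => ?_, ?_, ?_, fun x => ?_⟩
  · rw [h0, linForm_AW, mul_zero, add_zero]; simp
  · rw [h0, det_linForm_AW, mul_zero, add_zero]; simp
  · rw [h0, det_linForm_AW, mul_zero, add_zero]; simp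
  · rw [h0, re_quadForm_AW, mul_zero, add_zero]; simp

/-- **`hbud`, MET WITH MARGIN**: `detBudget 1 2 ϑW R′ = ϑW·R′ = 1 < d₀ = 2` at the operator radius `R′ := 1`. [folklore] -/
theorem hbud_W : ∀ (k : ℕ) (Z : D.carriers.Dom) (j : Unit),
    detBudget (Fintype.card ((mIW D) Z j)) ((fun (_ : D.carriers.Dom) (_ : Unit) => (2 : ℝ)) Z j)
      ((fun (_ : D.carriers.Dom) (_ : Unit) => ϑW) Z j) ((fun _ : ℕ => (1 : ℝ)) k) < (fun (_ : D.carriers.Dom) (_ : Unit) => (2 : ℝ)) Z j := by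
  intro k Z j; simp only [Fintype.card_fin, detBudget, ϑW]; norm_num

/-- **`hmq`, MET WITH MARGIN**: `card·ϑW·R′ = 1 < γ = 2` — so S30 §1's margin letter `mq = (γ − card·ϑ·R′)/2 = 1/2 > 0` is PROVED, not posited. [folklore] -/
theorem hmq_W : ∀ (k : ℕ) (Z : D.carriers.Dom) (j : Unit),
    Fintype.card ((mIW D) Z j) * (fun (_ : D.carriers.Dom) (_ : Unit) => ϑW) Z j * (fun _ : ℕ => (1 : ℝ)) k <
      (fun (_ : D.carriers.Dom) (_ : Unit) => (2 : ℝ)) Z j := by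
  intro k Z j; simp only [Fintype.card_fin, ϑW]; norm_num

/-! ## §3 The letters of the core of record `coreOf (coreLettersOf (AW D))` BY NAME -/

/-- The core letters of record of the datum (abbreviation). [folklore] -/
abbrev ℓW : ∀ (Z : D.carriers.Dom) (j : Unit), CoreLetters (PW D) ℂ (𝒵W D) (domW D) (JcW D) (VW D) Z j := coreLettersOf D (PW D) ℂ (𝒵W D) (domW D) (JcW D) (VW D) (mIW D) (AW D)

/-- **THE NORMALISATION LETTER OF RECORD IS LIVE IN THE OPERATOR DATUM**: `N o a = (2π)^{−1/2}·exp(log(2 + ϑW·o)/2)` (p3's `gaussN ∘ linForm`,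
`coreLettersOf_N` BY NAME). [folklore] -/
theorem N_ℓW (Z : D.carriers.Dom) (j : Unit) (o : ℂ) (a : (PEmpty.{1} ⊕ Unit) → ℝ × ℝ) :
    ((ℓW D) Z j).N o a = (gaussC (Fin 1) : ℂ) * cexp (Complex.log (2 + (ϑW : ℂ) * o) / 2) := by
  show (coreLettersOf D (PW D) ℂ (𝒵W D) (domW D) (JcW D) (VW D) (mIW D) (AW D) Z j).N o a = _
  rw [coreLettersOf_N]; unfold gaussN; rw [det_linForm_AW]
/-- AT THE CENTRE the normalisation is `(2π)^{−1/2}·√2 = π^{−1/2}`. [folklore] -/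
theorem N_ℓW_zero (Z : D.carriers.Dom) (j : Unit) (a : (PEmpty.{1} ⊕ Unit) → ℝ × ℝ) :
    ((ℓW D) Z j).N 0 a = ((Real.sqrt Real.pi)⁻¹ : ℝ) := by
  rw [N_ℓW, mul_zero, add_zero]
  have hlog : Complex.log 2 = ((Real.log 2 : ℝ) : ℂ) := by
    rw [← Complex.ofReal_ofNat 2, ← Complex.ofReal_log (by norm_num)]
  rw [hlog, show ((Real.log 2 : ℝ) : ℂ) / 2 = ((Real.log 2 / 2 : ℝ) : ℂ) by push_cast; ring, ← Complex.ofReal_exp,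
    ← Complex.ofReal_mul]
  congr 1
  rw [show Real.log 2 / 2 = Real.log 2 * (1 / 2) by ring, ← Real.rpow_def_of_pos two_pos, ← Real.sqrt_eq_rpow]
  unfold gaussC
  rw [Fintype.card_fin, pow_one, Real.sqrt_mul' _ Real.pi_pos.le]
  have h2 : Real.sqrt 2 ≠ 0 := (Real.sqrt_pos.2 (by norm_num)).ne'
  have hπ : Real.sqrt Real.pi ≠ 0 := (Real.sqrt_pos.2 Real.pi_pos).ne'
  field_simp
/-- **THE QUADRATIC-FORM LETTER OF RECORD IS LIVE IN THE OPERATOR DATUM**: `q o a v = ½·(2 + ϑW·o)·(v 0)²` (p3's `gaussQ ∘ linForm`,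
`coreLettersOf_q` BY NAME). [folklore] -/
theorem q_ℓW (Z : D.carriers.Dom) (j : Unit) (o : ℂ) (a : (PEmpty.{1} ⊕ Unit) → ℝ × ℝ) (v : E1) :
    ((ℓW D) Z j).q o a v = (1 / 2 : ℂ) * ((2 + (ϑW : ℂ) * o) * ((crd v : ℂ) ^ 2)) := by
  show (coreLettersOf D (PW D) ℂ (𝒵W D) (domW D) (JcW D) (VW D) (mIW D) (AW D) Z j).q o a v = _
  rw [coreLettersOf_q]; unfold gaussQ
  simp only [Fin.sum_univ_one, linForm_AW]
  show (1 / 2 : ℂ) * ((((LinearIsometry.id : E1 →ₗᵢ[ℝ] E1) v 0 : ℝ) : ℂ) * (2 + (ϑW : ℂ) * o) *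
      (((LinearIsometry.id : E1 →ₗᵢ[ℝ] E1) v 0 : ℝ) : ℂ)) = _
  rw [LinearIsometry.id_apply]; unfold crd; ring
/-- AT THE CENTRE the exponent is `‖v‖²` (W33∕W40's toy letter, now DERIVED from the table). [folklore] -/
theorem q_ℓW_zero (Z : D.carriers.Dom) (j : Unit) (a : (PEmpty.{1} ⊕ Unit) → ℝ × ℝ) (v : E1) :
    ((ℓW D) Z j).q 0 a v = ((‖v‖ ^ 2 : ℝ) : ℂ) := by
  rw [q_ℓW, mul_zero, add_zero, EuclideanSpace.norm_eq, Fin.sum_univ_one, Real.sq_sqrt (sq_nonneg _), Real.norm_eq_abs, sq_abs]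
  unfold crd; push_cast; ring


end Summit.QuantumFields.BalabanUV.T4Continuum.NE1p.DressedSmallFieldSlotLettersWitness
end
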